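import Mathlib
import HarnessLib
import Summits.NavierStokesRegularity.NavierStokesRegularity.Theorems.HalfSpaceWindowDoorCirculationCarryingRigidityRadialLift
import Summits.NavierStokesRegularity.NavierStokesRegularity.Theorems.HalfSpaceWindowDoorCirculationCarryingRigidityTransportLiouville
import Summits.NavierStokesRegularity.NavierStokesRegularity.Theorems.HalfSpaceWindowDoorCirculationCarryingRigidityRotate

/-!
# Route `HalfSpaceWindowDoor`, crux `CirculationCarryingRigidity` (stmt-NavierStokesRegularity-25311) —
# line `cone_sweep`: the CRUX itself, BY NAME, from the radial-lift / transport bound about one axis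

LEAD ns-hsw-p1 g9, `--supports stmt-NavierStokesRegularity-25311 --as helper`; card `Cruxes/…/Lines/cone_sweep.md` v2.4.  Composition of the
landed plumbing stub `…Rotate.stub_rotate : HemisphereLiouvilleE3 → CirculationCarryingRigidity` (p611557, rotation covariance) with the by-name
reductions of `HemisphereLiouvilleE3` proved by the line (`…TransportLiouville` p687487, `…RecordLiouville` p688291, `…RadialLift` p688620):
the route's crux `Theses.HalfSpaceWindowDoor.CirculationCarryingRigidity` (all directions `e ≠ 0`) FOLLOWS from each of
* the one-sided far-circle TRANSPORT BOUND about the `e₃`-axis for every closed-`e₃`-hemisphere door-class profile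
  (`circulationCarryingRigidity_of_transportBound`);
* the same bound only on RECORD circles of one far-past epoch (`circulationCarryingRigidity_of_recordTransportBound`);
* the RADIAL-LIFT bound `∮ω_r v₃ dl ≤ (B/√(−t))∮ω₃ dl` on those record circles (`circulationCarryingRigidity_of_radialLiftBound`).
These are census statements (conditional reductions); the hypotheses are NOT proved — they are exactly what is left of the open research stub
`stub_layerExclusion ≡ HemisphereLiouvilleE3` (W6).  WHAT THIS IS NOT: not about NS regularity; HYPOTHETICAL profiles; no item is closed.
-/

noncomputable section

-- the summit and its single sub-problem share the name (CONVENTIONS §1), as in every Theorems file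
set_option linter.dupNamespace false

namespace Summit.NavierStokesRegularity.NavierStokesRegularity.Theorems.HalfSpaceWindowDoorCirculationCarryingRigidityCruxReduction

open MeasureTheory Set Function Filter Topology InnerProductSpace
open scoped RealInnerProductSpace InnerProductSpace
open Literature.Analysis Literature.Analysis.UnboundedOperators
open Literature.Analysis.FluidPDE hiding eR
open Summit.NavierStokesRegularity.NavierStokesRegularity.Theses.HalfSpaceWindowDoor (CirculationCarryingRigidity)
open Summit.NavierStokesRegularity.NavierStokesRegularity.Theorems.HalfSpaceWindowDoorCirculationCarryingRigidityDefs
  (InDoorClass SignE3 e3 HemisphereLiouvilleE3)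
open Summit.NavierStokesRegularity.NavierStokesRegularity.Theorems.AxisTwistDoorAveragedConeLiouvilleDefs
  (cylPt eR circ vortCirc circleTerm)
open Summit.NavierStokesRegularity.NavierStokesRegularity.Theorems.HalfSpaceWindowDoorCirculationCarryingRigidityRotate (stub_rotate)
open Summit.NavierStokesRegularity.NavierStokesRegularity.Theorems.HalfSpaceWindowDoorCirculationCarryingRigidityTransportLiouville
  (hemisphereLiouvilleE3_of_transportBound)
open Summit.NavierStokesRegularity.NavierStokesRegularity.Theorems.HalfSpaceWindowDoorCirculationCarryingRigidityRecordLiouville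
  (hemisphereLiouvilleE3_of_recordTransportBound)
open Summit.NavierStokesRegularity.NavierStokesRegularity.Theorems.HalfSpaceWindowDoorCirculationCarryingRigidityRadialLift
  (hemisphereLiouvilleE3_of_radialLiftBound)

/-- **The crux from the far-circle transport bound about the `e₃`-axis** (rotation covariance ∘ `hemisphereLiouvilleE3_of_transportBound`). -/
theorem circulationCarryingRigidity_of_transportBound
    (H : ∀ (C : ℝ) (v : ℝ → EuclideanSpace ℝ (Fin 3) → EuclideanSpace ℝ (Fin 3)), InDoorClass C v → SignE3 v →
      ∃ B : ℝ, 0 ≤ B ∧ ∃ R₀ : ℝ, 0 ≤ R₀ ∧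
        ∀ s < 0, ∀ r : ℝ, R₀ * Real.sqrt (-s) ≤ r → ∀ z : ℝ, -circleTerm v r z s ≤ B / Real.sqrt (-s) * vortCirc v r z s) :
    CirculationCarryingRigidity :=
  stub_rotate (hemisphereLiouvilleE3_of_transportBound H)

/-- **The crux from the transport bound on the RECORD circles of one far-past epoch**
(rotation covariance ∘ `hemisphereLiouvilleE3_of_recordTransportBound`). -/
theorem circulationCarryingRigidity_of_recordTransportBound
    (H : ∀ (C : ℝ) (v : ℝ → EuclideanSpace ℝ (Fin 3) → EuclideanSpace ℝ (Fin 3)), InDoorClass C v → SignE3 v →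
      ∃ B : ℝ, 0 ≤ B ∧ ∃ R₀ : ℝ, 0 ≤ R₀ ∧ ∃ σ₀ : ℝ, σ₀ < 0 ∧
        ∀ t : ℝ, t ≤ σ₀ → ∀ r : ℝ, R₀ * Real.sqrt (-t) ≤ r → ∀ z : ℝ,
          (∀ s' : ℝ, s' ≤ t → ∀ z' : ℝ, circ v ((4 * B + R₀ + 1) * Real.sqrt (-s')) z' s' < circ v r z t) →
          -circleTerm v r z t ≤ B / Real.sqrt (-t) * vortCirc v r z t) :
    CirculationCarryingRigidity :=
  stub_rotate (hemisphereLiouvilleE3_of_recordTransportBound H)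

/-- **The crux from the RADIAL-LIFT bound on the record circles of one far-past epoch**
(rotation covariance ∘ `hemisphereLiouvilleE3_of_radialLiftBound`) — the census form of what is left of W6. -/
theorem circulationCarryingRigidity_of_radialLiftBound
    (H : ∀ (C : ℝ) (v : ℝ → EuclideanSpace ℝ (Fin 3) → EuclideanSpace ℝ (Fin 3)), InDoorClass C v → SignE3 v →
      ∃ B : ℝ, 0 ≤ B ∧ ∃ R₀ : ℝ, 0 ≤ R₀ ∧ ∃ σ₀ : ℝ, σ₀ < 0 ∧
        ∀ t : ℝ, t ≤ σ₀ → ∀ r : ℝ, R₀ * Real.sqrt (-t) ≤ r → ∀ z : ℝ,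
          (∀ s' : ℝ, s' ≤ t → ∀ z' : ℝ, circ v ((4 * (B + C) + R₀ + 1) * Real.sqrt (-s')) z' s' < circ v r z t) →
          (∫ θ in (0 : ℝ)..(2 * Real.pi), ⟪curl (v t) (cylPt r θ z), eR θ⟫ *
            ⟪v t (cylPt r θ z), Summit.NavierStokesRegularity.NavierStokesRegularity.Theorems.AxisTwistDoorAveragedConeLiouvilleDefs.e3⟫ * r) ≤
            B / Real.sqrt (-t) * vortCirc v r z t) :
    CirculationCarryingRigidity :=
  stub_rotate (hemisphereLiouvilleE3_of_radialLiftBound H)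

end Summit.NavierStokesRegularity.NavierStokesRegularity.Theorems.HalfSpaceWindowDoorCirculationCarryingRigidityCruxReduction

end
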